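import Summits.Schanuel.Schanuel.Theorems.RootDecomp1KThueMahler03

/-!
# RootDecomp1KThueMahler — lens 1, generation 56, NODE 16 «THUE–MAHLER ON THE LINE» (RULE K-R46 payable clause; CLAIM L2656, PRICE L2660) — continuation (RootDecomp1KThueMahler04): §8 the members L17C, E17C, LD17 D, §9 erratum of record L17P, §10 sharpness

(lens-1 g56 NODE 16 HOME kernel K = HOME/decomp-schanuel-lens-1/g56/ThueMahler.lean d10a59d7…, 957 l, 92 thm + 7 def, imports tree …RootDecomp1KIntegrality04 ONLY (no Literature import, no fact def, no private / set_option); Probe / Ctrl0 / Ctrl + NODE-g56.md + presearch_g56.txt + SHA256SUMS; CLAIM L2656, census LIVENESS-v5 node-16 rows L2657 (of record L2661 (A)), crit EX-ANTE PRICE L2660 (ONE THEOREM ×1 under K-R46's payable clause «an infinite class of AMENDED-FRONTIER pairs made unconditional by an input outside the toolkit of record» iff CHECKLIST K-g56; hand check of the Thue–Mahler mechanism SOUND), crit RULING L2661 (B) (L17P ERRATUM of record: `L17P = normShapeCurve (−(Y+3)) (Y²−17) 1 1` is LEVEL-FINITE hyp-free by node 10), NODE L2664, critic VERDICT L2665: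 CLEARED — THEOREM ×1 under K-R46's payable clause (EX-ANTE PRICE L2660), CHECKLIST K-g56 (1)–(10) MET; erratum §9 = ×0 bookkeeping as RULED L2661 (B); RULE K-R47 FIXED (toolkit of record ∪ {multi-form elimination at the odd places (`exists_resultant_bound`, two charts), archimedean floor (`exists_arch_floor`), product-formula transfer (`abs_mul_norm_le_of_odd_part`, `hform_eq_prod`), height-fed Ridout/Liouville closing}; FRONTIER re-amended by «NOT LEVEL-FINITE by the {2, ∞} Thue–Mahler reduction (XLinTM)»; open territory of record at m₀ = 2 := x-degree ≥ 2 members with |J_D| ≥ 2 or J_D = {j₀ ≥ 1} (M17P the standing witness) ∪ x-linear pairs outside XLinTM); PORT GO (K verbatim; docstrings/provenance only; «cite-token» spelling incl. «Mahler1933»; dedup 0) — census STAGING NOTE 6 L2667, crit ACK L2668 (staging sanctioned; identity-diff expectation identical 98 · MOD 3 · differ 0). Port by census-1 gen 22 as `RootDecomp1KThueMahler01–04` (`--supports stmt-Schanuel-33364`; no census credit): 01 = §1 COPRIMALITY (no common root, the two charts, the RESULTANT BOUND on common divisors of the binary forms) + §2 THE ODD PART (`|F|·‖F‖₂ ≤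 |d₀|`) + §3 THE ARCHIMEDEAN FLOOR + §4 the bounded dyadic points `DyadicPt A B M r`, the integers `F_A`, `F_B` and the `2`-adic side; 02 = §5 THE THEOREM **`finite_dyadicPts`** (Thue–Mahler on the line: finitely many bounded dyadic points), **`levelFinite_xLinear_sep3 : LevelFinite (xLinP A B)`** and **`thinFibreAt_xLinear_sep3 : ThinFibreAt m₀ (xLinP A B)` for EVERY `m₀`** (B separable over ℚ, `3 ≤ deg B`, `deg A ≤ deg B`, `A ⊥ B`), the class predicate **`XLinTM P`**, `levelFinite_of_xLinTM` + §6 the odd-part lever by name `odd_dvd_resultant_of_onLevel` (Mahler 1933); 03 = §7 the x-linear presentation toolkit (`linC`, `xdeg_xLinP`, …) and the TERRITORY certificates by tree names; 04 = §8 the members **`L17C = (Y+3) + x(Y³−17)`**, **`E17C = (Y³+3) + x(Y³−17)`** and the infinite family **`LD17 D = (Y+3) + x(Y^D − 17)`, `D ≥ 3`** (`thinFibreAt_LD17` hyp-free, every `m₀`; `¬ DecidedAt 2`, `¬ LocalAt 2`, `¬ GaussAt`, `¬ HeightDecidedAt 2`, not of norm shape, `3 ≤ thinThreshold`) + §9 ERRATUM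 OF RECORD `L17P_eq_normShapeCurve` / `normShapeHyp_L17P` / `thinFibreAt_L17P_all` (hyp-free by node 10; ×0) + §10 sharpness and costume arithmetic. PORT EDITS: THREE one-line helpers PRIVATISED (file-local copies where used in a later part) — K's `isCoprime_num_den` (public twin `Literature.…SparseDyadicRationals.isCoprime_num_den` outside the import closure; private copies already in LevelFinite03/04/08/09), `isCoprime_two_pow_of_odd'` and `norm_intCast_Cp_le_one` (head dry-run dedup.foreign: print like BirchSwinnertonDyer decls) —; 30 one-line docstrings on undocumented computation lemmas of §7–§9 (statements quoted); otherwise none (no dedup.landed twin, no set_option, no cite-token in a def docstring); provenance doc blocks + continuation headers = K's own open-lines; statements and proofs VERBATIM. Rung 0 — nothing here proves Schanuel, 33364, 33363, 31077 or ThinFibre 2; the class, the members and the family are HYPOTHESIS-FREE (the one external theorem used is the tree's proved `ridout_window_pow`).)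
-/

noncomputable section

namespace Summit.Schanuel.Schanuel.Theorems.RootDecomp1KThueMahler

open Polynomial LiouvilleNumber
open scoped Nat
open Summit.Schanuel.Schanuel.Theorems.RootDecomp1KTwoBaseCell (psNumer)
open Summit.Schanuel.Schanuel.Theorems.RootDecomp1KDegreeLadder
open Summit.Schanuel.Schanuel.Theorems.RootDecomp1KXLinear
open Summit.Schanuel.Schanuel.Theorems.RootDecomp1KXLinearII
open Summit.Schanuel.Schanuel.Theorems.RootDecomp1KXAll
open Summit.Schanuel.Schanuel.Theorems.RootDecomp1KLevelFinite
open Summit.Schanuel.Schanuel.Theorems.RootDecomp1KSubspaceBranch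
open Summit.Schanuel.Schanuel.Theorems.RootDecomp1KXTop
open Summit.Schanuel.Schanuel.Theorems.RootDecomp1KLocalExponent
open Summit.Schanuel.Schanuel.Theorems.RootDecomp1KIntegrality
open Summit.Schanuel.Schanuel.Theorems.RootDecomp1KHeightGrading
open Summit.Schanuel.Schanuel.Theorems.RootDecomp1KHeightMachine

/-! ## §8  THE MEMBERS: `L17C`, `E17C` and the infinite family `LD17 D`, `D ≥ 3` (AMENDED-FRONTIER of record at `m₀ = 2`) -/

/-- the pure binomial `Y^D − 17`. -/
def b17 (D : ℕ) : ℤ[X] := X ^ D - C 17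

/-- `(b17 D).natDegree = D`. -/
theorem natDegree_b17 (D : ℕ) : (b17 D).natDegree = D := by rw [b17, natDegree_X_pow_sub_C]

/-- `b17 D ≠ 0` for `1 ≤ D`. -/
theorem b17_ne_zero {D : ℕ} (hD : 1 ≤ D) : b17 D ≠ 0 := fun h => by
  have := natDegree_b17 D; rw [h, natDegree_zero] at this; omega

/-- `(b17 D).map (Int.castRingHom ℚ) = X ^ D - C 17` over `ℚ`. -/
theorem map_b17 (D : ℕ) : (b17 D).map (Int.castRingHom ℚ) = X ^ D - C (17 : ℚ) := by
  rw [b17, Polynomial.map_sub, Polynomial.map_pow, Polynomial.map_X, Polynomial.map_C]; simp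

/-- `Y^D − 17` is separable over `ℚ` (`D ≥ 1`). -/
theorem separable_b17 {D : ℕ} (hD : 1 ≤ D) : ((b17 D).map (Int.castRingHom ℚ)).Separable := by
  rw [map_b17]
  exact separable_X_pow_sub_C _ (by exact_mod_cast (show D ≠ 0 by omega)) (by norm_num)

/-- `aeval z (b17 D) = z ^ D - 17` in any commutative `ℤ`-algebra. -/
theorem aeval_b17 {R : Type*} [CommRing R] [Algebra ℤ R] (D : ℕ) (z : R) : aeval z (b17 D) = z ^ D - 17 := by
  rw [b17, map_sub, map_pow, aeval_X, aeval_C]; simp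

/-- `17` is no `D`-th power of a rational for `D ≥ 2`: `Y^D − 17` has NO rational root. -/
theorem aeval_b17_ne_zero_rat {D : ℕ} (hD : 2 ≤ D) (q : ℚ) : aeval q (b17 D) ≠ 0 := by
  rw [aeval_b17, sub_ne_zero]
  intro hq
  have hx : ((q : ℝ)) ^ D = ((17 : ℤ) : ℝ) := by
    have := congrArg (fun t : ℚ => (t : ℝ)) hq
    push_cast at this ⊢
    exact this
  by_cases hint : ∃ y : ℤ, (q : ℝ) = y
  · obtain ⟨y, hy⟩ := hint
    rw [hy] at hx
    have hy' : y ^ D = 17 := by exact_mod_cast hx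
    have hn : y.natAbs ^ D = 17 := by
      have := congrArg Int.natAbs hy'
      rwa [Int.natAbs_pow] at this
    have := ((Nat.Prime.pow_eq_iff (by norm_num : Nat.Prime 17)).mp hn).2
    omega
  · exact (Rat.not_irrational q) (irrational_nrt_of_notint_nrt D 17 hx hint (by omega))

/-- for ODD `D`, `17^{1/D} ∈ ℤ₂` (Hensel at `1`: `‖1 − 17‖₂ = 2^{−4} < ‖D‖₂² = 1`): `Y^D − 17` HAS a root in `ℚ₂`. -/
theorem exists_padic_root_b17 {D : ℕ} (hD : Odd D) : ∃ z : ℚ_[2], aeval z (b17 D) = 0 := by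
  have hD0 : D ≠ 0 := by rintro rfl; exact (Nat.not_even_iff_odd.mpr hD) ⟨0, rfl⟩
  have hnormD : ‖((D : ℕ) : ℤ_[2])‖ = 1 := PadicInt.norm_natCast_eq_one_iff.mpr (Nat.coprime_two_left.mpr hD)
  have h2 : ‖(2 : ℤ_[2])‖ = 1 / 2 := by
    have := PadicInt.norm_p (p := 2); simpa using this
  have hF : ‖aeval (1 : ℤ_[2]) (b17 D)‖ < ‖aeval (1 : ℤ_[2]) (derivative (b17 D))‖ ^ 2 := by
    have e1 : aeval (1 : ℤ_[2]) (b17 D) = -(2 ^ 4) := by rw [aeval_b17, one_pow]; norm_num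
    have e2 : aeval (1 : ℤ_[2]) (derivative (b17 D)) = (D : ℕ) := by
      rw [b17, derivative_sub, derivative_X_pow, derivative_C, sub_zero]
      simp
    rw [e1, e2, norm_neg, norm_pow, h2, hnormD]; norm_num
  obtain ⟨z, hz, -⟩ := hensels_lemma hF
  refine ⟨(z : ℚ_[2]), ?_⟩
  have := Polynomial.aeval_algebraMap_apply ℚ_[2] z (b17 D)
  rw [hz, map_zero] at this
  simpa using this

/-- `Y + 3 ⊥ Y^D − 17` over `ℚ` (`(−3)^D ≠ 17`). -/
theorem isCoprime_X_add_three_b17 (D : ℕ) :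
    IsCoprime ((X + C 3 : ℤ[X]).map (Int.castRingHom ℚ)) ((b17 D).map (Int.castRingHom ℚ)) := by
  refine (Polynomial.isCoprime_iff_aeval_ne_zero_of_isAlgClosed (k := ℚ) (K := ℂ) _ _).mpr fun z => ?_
  by_cases hz : z = -3
  · right
    rw [← algebraMap_int_eq, aeval_map_algebraMap, aeval_b17, hz, sub_ne_zero]
    intro h
    have h1 : ((-3 : ℤ) : ℂ) ^ D = ((17 : ℤ) : ℂ) := by push_cast; exact h
    have h2 : (-3 : ℤ) ^ D = 17 := by exact_mod_cast h1
    have h3 : (3 : ℕ) ^ D = 17 := by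
      have := congrArg Int.natAbs h2
      rwa [Int.natAbs_pow] at this
    have := ((Nat.Prime.pow_eq_iff (by norm_num : Nat.Prime 17)).mp h3).1
    omega
  · left
    rw [← algebraMap_int_eq, aeval_map_algebraMap, map_add, aeval_X, aeval_C]
    simp only [algebraMap_int_eq, eq_intCast, Int.cast_ofNat, ne_eq]
    intro h; exact hz (by linear_combination h)

/-- `Y³ + 3 ⊥ Y³ − 17` over `ℚ` (a common root would give `20 = 0`). -/
theorem isCoprime_cube_add_three_b17 :
    IsCoprime ((X ^ 3 + C 3 : ℤ[X]).map (Int.castRingHom ℚ)) ((b17 3).map (Int.castRingHom ℚ)) := by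
  refine (Polynomial.isCoprime_iff_aeval_ne_zero_of_isAlgClosed (k := ℚ) (K := ℂ) _ _).mpr fun z => ?_
  by_contra h
  simp only [not_or, not_not, ← algebraMap_int_eq, aeval_map_algebraMap, aeval_b17, map_add, map_pow, aeval_X,
    aeval_C] at h
  simp only [algebraMap_int_eq, eq_intCast, Int.cast_ofNat] at h
  have := h.1
  have := h.2
  have : (20 : ℂ) = 0 := by linear_combination h.1 - h.2
  norm_num at this

/-- **THE INFINITE FAMILY** `LD17 D := (Y + 3) + x·(Y^D − 17)`. -/
def LD17 (D : ℕ) : ℤ[X][X] := xLinP (X + C 3) (b17 D)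

/-- **the member `L17C := (Y + 3) + x·(Y³ − 17)`** (`= LD17 3`; `J_D = {1}`). -/
def L17C : ℤ[X][X] := xLinP (X + C 3) (X ^ 3 - C 17)

/-- **the member `E17C := (Y³ + 3) + x·(Y³ − 17)`** (`deg A = deg B = 3`, `|J_D| = 2`). -/
def E17C : ℤ[X][X] := xLinP (X ^ 3 + C 3) (X ^ 3 - C 17)

/-- `L17C = LD17 3` (by `rfl`). -/
theorem L17C_eq : L17C = LD17 3 := rfl
/-- `E17C = xLinP (X ^ 3 + C 3) (b17 3)` (by `rfl`). -/
theorem E17C_eq : E17C = xLinP (X ^ 3 + C 3) (b17 3) := rfl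

/-- `xLinP A B ≠ 0` as soon as `1 ≤ B.natDegree`. -/
theorem xLinP_ne_zero_of_right (A B : ℤ[X]) (hB : 1 ≤ B.natDegree) : xLinP A B ≠ 0 := fun h => by
  have hB0 : B ≠ 0 := fun h0 => by rw [h0, natDegree_zero] at hB; omega
  have := natDegree_xLinP_ge_right A B hB0
  rw [h, natDegree_zero] at this
  omega

/-- `LD17 D ≠ 0` for `1 ≤ D`. -/
theorem LD17_ne_zero {D : ℕ} (hD : 1 ≤ D) : LD17 D ≠ 0 := xLinP_ne_zero_of_right _ _ (by rw [natDegree_b17]; exact hD)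
/-- `L17C ≠ 0`. -/
theorem L17C_ne_zero : L17C ≠ 0 := LD17_ne_zero (D := 3) (by norm_num)
/-- `E17C ≠ 0`. -/
theorem E17C_ne_zero : E17C ≠ 0 := xLinP_ne_zero_of_right _ (b17 3) (by rw [natDegree_b17]; norm_num)

/-- `(X + C 3 : ℤ[X]).natDegree = 1`. -/
theorem natDegree_X_add_three : (X + C 3 : ℤ[X]).natDegree = 1 := natDegree_X_add_C 3
/-- `(X ^ 3 + C 3 : ℤ[X]).natDegree = 3`. -/
theorem natDegree_cube_add_three : (X ^ 3 + C 3 : ℤ[X]).natDegree = 3 := natDegree_X_pow_add_C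

/-- **membership**: `LD17 D ∈ XLinTM` for every `D ≥ 3`. -/
theorem xLinTM_LD17 {D : ℕ} (hD : 3 ≤ D) : XLinTM (LD17 D) :=
  ⟨X + C 3, b17 D, separable_b17 (by omega), by rw [natDegree_b17]; exact hD,
    by rw [natDegree_X_add_three, natDegree_b17]; omega, isCoprime_X_add_three_b17 D, rfl⟩

/-- `XLinTM L17C` (the member `L17C = LD17 3` is in the Thue–Mahler class). -/
theorem xLinTM_L17C : XLinTM L17C := xLinTM_LD17 le_rfl

/-- `XLinTM E17C` (`B = Y³ − 17` separable of degree `3`, `A = Y³ + 3` of degree `≤ 3`, `A ⊥ B`). -/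
theorem xLinTM_E17C : XLinTM E17C :=
  ⟨X ^ 3 + C 3, b17 3, separable_b17 (by norm_num), by rw [natDegree_b17],
    by rw [natDegree_cube_add_three, natDegree_b17], isCoprime_cube_add_three_b17, rfl⟩

/-- **`ThinFibreAt m₀ (LD17 D)` for EVERY `D ≥ 3` and EVERY `m₀`, HYPOTHESIS-FREE** (the infinite family theorem). -/
theorem thinFibreAt_LD17 {D : ℕ} (hD : 3 ≤ D) (m₀ : ℕ) : ThinFibreAt m₀ (LD17 D) := thinFibreAt_of_xLinTM (xLinTM_LD17 hD) m₀

/-- `LevelFinite (LD17 D)` for `3 ≤ D`, HYPOTHESIS-FREE (from `levelFinite_of_xLinTM`). -/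
theorem levelFinite_LD17 {D : ℕ} (hD : 3 ≤ D) : LevelFinite (LD17 D) := levelFinite_of_xLinTM (xLinTM_LD17 hD)

/-- **`ThinFibreAt m₀ L17C` at EVERY `m₀` (incl. `2`), HYPOTHESIS-FREE.** -/
theorem thinFibreAt_L17C_all (m₀ : ℕ) : ThinFibreAt m₀ L17C := thinFibreAt_of_xLinTM xLinTM_L17C m₀

/-- `ThinFibreAt 2 L17C`, HYPOTHESIS-FREE (the amended-frontier value `m₀ = 2`). -/
theorem thinFibreAt_two_L17C : ThinFibreAt 2 L17C := thinFibreAt_L17C_all 2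

/-- **`ThinFibreAt m₀ E17C` at EVERY `m₀`, HYPOTHESIS-FREE.** -/
theorem thinFibreAt_E17C_all (m₀ : ℕ) : ThinFibreAt m₀ E17C := thinFibreAt_of_xLinTM xLinTM_E17C m₀

/-- `ThinFibreAt 2 E17C`, HYPOTHESIS-FREE (the amended-frontier value `m₀ = 2`). -/
theorem thinFibreAt_two_E17C : ThinFibreAt 2 E17C := thinFibreAt_E17C_all 2

/-! ### The territory certificates (the members lie in NO class decided at `m₀ = 2` in the tree; LIVENESS-v5 rows of record) -/

/-- uniform in ODD `D ≥ 3`: the top `Y^D − 17` has an IRRATIONAL simple `ℚ₂`-root — `¬ LocalAt 2`, `¬ DecidedAt 2`,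
`¬ GaussAt 2`, `¬ HeightDecidedAt 2`, not of norm shape. -/
theorem not_localAt_two_LD17 {D : ℕ} (hD : 3 ≤ D) (hodd : Odd D) : ¬ LocalAt 2 (LD17 D) := by
  obtain ⟨z, hz⟩ := exists_padic_root_b17 hodd
  exact not_localAt_xLinP _ _ (b17_ne_zero (by omega)) hz (aeval_b17_ne_zero_rat (by omega)) le_rfl

/-- `¬ DecidedAt 2 (LD17 D)` for odd `D ≥ 3` (territory certificate: outside node 13's decided class at `m₀ = 2`). -/
theorem not_decidedAt_two_LD17 {D : ℕ} (hD : 3 ≤ D) (hodd : Odd D) : ¬ DecidedAt 2 (LD17 D) := by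
  obtain ⟨z, hz⟩ := exists_padic_root_b17 hodd
  exact not_decidedAt_two_xLinP _ _ (b17_ne_zero (by omega)) (by rw [natDegree_X_add_three, natDegree_b17]; omega)
    (by rw [natDegree_b17]; omega) hz

/-- `¬ GaussAt m₀ (LD17 D)` for `1 ≤ D` and every `m₀` (territory certificate: node 15's integrality class does not contain the family). -/
theorem not_gaussAt_LD17 {D : ℕ} (hD : 1 ≤ D) (m₀ : ℕ) : ¬ GaussAt m₀ (LD17 D) :=
  not_gaussAt_xLinP _ _ (b17_ne_zero hD) (by rw [natDegree_X_add_three, natDegree_b17]; exact hD) m₀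

/-- `¬ HeightDecidedAt 2 (LD17 D)` for `2 ≤ D` (territory certificate at `m₀ = 2`). -/
theorem not_heightDecidedAt_two_LD17 {D : ℕ} (hD : 2 ≤ D) : ¬ HeightDecidedAt 2 (LD17 D) :=
  not_heightDecidedAt_xLinP _ _ (b17_ne_zero (by omega)) (by rw [natDegree_b17]; exact hD)

/-- `LD17 D ≠ normShapeCurve g q a D'` for odd `D` whenever `NormShapeHyp g q a D'` (the family is not of node 10's norm shape). -/
theorem LD17_ne_normShapeCurve {D : ℕ} (hodd : Odd D) (g q : ℤ[X]) (a : ℕ) (D' : ℤ) (hH : NormShapeHyp g q a D') :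
    LD17 D ≠ normShapeCurve g q a D' :=
  xLinP_ne_normShapeCurve_of_odd (by rw [natDegree_b17]; exact hodd) g q a D' hH

/-- the separable x-linear disjunct of `DecidedAt m₀` needs `3 ≤ m₀`: refused at `2` for ANY curve. -/
theorem not_xLinear_sep_two (P : ℤ[X][X]) : ¬ (3 ≤ 2 ∧ ∃ A B : ℤ[X], (B.map (Int.castRingHom ℚ)).Separable ∧ P = xLinP A B) :=
  fun h => absurd h.1 (by norm_num)

/-- `3 ≤ thinThreshold (LD17 D)` (node 4's threshold does not reach `m₀ = 2` on the family). -/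
theorem three_le_thinThreshold_LD17 (D : ℕ) : 3 ≤ thinThreshold (LD17 D) := three_le_thinThreshold _

/-- **`L17C`: the territory conjunction** — in NO class decided at `m₀ = 2` in the tree, yet `ThinFibreAt 2 L17C` HOLDS, hyp-free. -/
theorem L17C_territory :
    ¬ DecidedAt 2 L17C ∧ ¬ LocalAt 2 L17C ∧ ¬ GaussAt 2 L17C ∧ ¬ HeightDecidedAt 2 L17C ∧
      (∀ g q a D, NormShapeHyp g q a D → L17C ≠ normShapeCurve g q a D) ∧ 3 ≤ thinThreshold L17C ∧
      ∀ m₀, ThinFibreAt m₀ L17C :=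
  ⟨not_decidedAt_two_LD17 le_rfl ⟨1, rfl⟩, not_localAt_two_LD17 le_rfl ⟨1, rfl⟩, not_gaussAt_LD17 (by norm_num) 2,
    not_heightDecidedAt_two_LD17 (by norm_num), fun g q a D hH => LD17_ne_normShapeCurve ⟨1, rfl⟩ g q a D hH,
    three_le_thinThreshold _, thinFibreAt_L17C_all⟩

/-- **`E17C`: the territory conjunction** (same top `Y³ − 17`). -/
theorem E17C_territory :
    ¬ DecidedAt 2 E17C ∧ ¬ LocalAt 2 E17C ∧ ¬ GaussAt 2 E17C ∧ ¬ HeightDecidedAt 2 E17C ∧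
      (∀ g q a D, NormShapeHyp g q a D → E17C ≠ normShapeCurve g q a D) ∧ 3 ≤ thinThreshold E17C ∧
      ∀ m₀, ThinFibreAt m₀ E17C := by
  obtain ⟨z, hz⟩ := exists_padic_root_b17 (D := 3) ⟨1, rfl⟩
  have hB : b17 3 ≠ 0 := b17_ne_zero (by norm_num)
  have hd3 : (b17 3).natDegree = 3 := natDegree_b17 3
  rw [E17C_eq]
  refine ⟨?_, ?_, ?_, ?_, ?_, three_le_thinThreshold _, thinFibreAt_E17C_all⟩
  · exact not_decidedAt_two_xLinP _ _ hB (by rw [natDegree_cube_add_three, hd3]) (by rw [hd3]; norm_num) hz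
  · exact not_localAt_xLinP _ _ hB hz (aeval_b17_ne_zero_rat (by norm_num)) le_rfl
  · exact not_gaussAt_xLinP _ _ hB (by rw [natDegree_cube_add_three, hd3]) 2
  · exact not_heightDecidedAt_xLinP _ _ hB (by rw [hd3]; norm_num)
  · exact fun g q a D hH => xLinP_ne_normShapeCurve_of_odd (by rw [hd3]; exact ⟨1, rfl⟩) g q a D hH

/-- **THE INFINITE FAMILY of AMENDED-FRONTIER members made unconditional, uniform in ODD `D ≥ 3`:**
territory (`¬ DecidedAt 2`, `¬ LocalAt 2`, `¬ GaussAt 2`, `¬ HeightDecidedAt 2`, not of norm shape, `∃` `ℚ₂`-root of the top)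
AND `ThinFibreAt m₀ (LD17 D)` for every `m₀`. -/
theorem LD17_territory {D : ℕ} (hD : 3 ≤ D) (hodd : Odd D) :
    (∃ z : ℚ_[2], aeval z (b17 D) = 0) ∧ ¬ DecidedAt 2 (LD17 D) ∧ ¬ LocalAt 2 (LD17 D) ∧ ¬ GaussAt 2 (LD17 D) ∧
      ¬ HeightDecidedAt 2 (LD17 D) ∧ (∀ g q a D', NormShapeHyp g q a D' → LD17 D ≠ normShapeCurve g q a D') ∧
      ∀ m₀, ThinFibreAt m₀ (LD17 D) :=
  ⟨exists_padic_root_b17 hodd, not_decidedAt_two_LD17 hD hodd, not_localAt_two_LD17 hD hodd, not_gaussAt_LD17 (by omega) 2,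
    not_heightDecidedAt_two_LD17 (by omega), fun g q a D' hH => LD17_ne_normShapeCurve hodd g q a D' hH, thinFibreAt_LD17 hD⟩

/-! ## §9  ERRATUM OF RECORD: `L17P = (Y + 3) + x·(Y² − 17)` IS a conjugate-poles shape curve of node 10 (`a = 1`, `D = 1`),
hence `ThinFibreAt m₀ L17P` at EVERY `m₀` HYPOTHESIS-FREE (node 11's `thinFibreAt_L17P (hS : PadicSubspace)` superseded as a
status, kept as history; writer's independent check L2658, critic's ruling L2661 (B)) -/

/-- ERRATUM OF RECORD: `L17P = normShapeCurve (-(X + C 3)) (X ^ 2 - C 17) 1 1` (node 10's conjugate-poles shape with `a = 1`, `D = 1`). -/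
theorem L17P_eq_normShapeCurve : L17P = normShapeCurve (-(X + C 3)) (X ^ 2 - C 17) 1 1 := by
  rw [normShapeCurve_eq_xLinP, neg_neg, map_one, one_mul, pow_one]; rfl

/-- `NormShapeHyp (-(X + C 3)) (X ^ 2 - C 17) 1 1` — the norm-shape hypotheses hold for `L17P` clause by clause. -/
theorem normShapeHyp_L17P : NormShapeHyp (-(X + C 3)) (X ^ 2 - C 17) 1 1 := by
  refine ⟨natDegree_X_pow_sub_C, fun t => ?_, fun z hz => ?_, le_rfl, ?_, one_ne_zero⟩
  · have : (X ^ 2 - C 17 : ℤ[X]) = b17 2 := rfl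
    rw [this]; exact aeval_b17_ne_zero_rat le_rfl t
  · have e1 : aeval z (X ^ 2 - C 17 : ℤ[X]) = z ^ 2 - 17 := aeval_b17 2 z
    rw [e1, sub_eq_zero] at hz
    rw [map_neg, map_add, aeval_X, aeval_C, neg_ne_zero]
    simp only [algebraMap_int_eq, eq_intCast, Int.cast_ofNat, ne_eq]
    intro h
    have hz3 : z = -3 := by linear_combination h
    rw [hz3] at hz; norm_num at hz
  · rw [natDegree_neg, natDegree_X_add_three]; norm_num

/-- **`LevelFinite L17P`**, hypothesis-free (node 10's `levelFinite_normShapeCurve`). -/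
theorem levelFinite_L17P : LevelFinite L17P := by
  rw [L17P_eq_normShapeCurve]; exact levelFinite_normShapeCurve normShapeHyp_L17P

/-- **`ThinFibreAt m₀ L17P` at EVERY `m₀`, HYPOTHESIS-FREE** (no `PadicSubspace`). -/
theorem thinFibreAt_L17P_all (m₀ : ℕ) : ThinFibreAt m₀ L17P := by
  rw [L17P_eq_normShapeCurve]; exact thinFibreAt_normShapeCurve normShapeHyp_L17P m₀

/-! ## §10  SHARPNESS AND COSTUME ARITHMETIC (the hypotheses are the ℚ-spellings of the tree; the ℤ[X]-spellings are STRICTLY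
STRONGER and FALSE for the member `L17C`; `D = 2` is `L17P` (node 10, not this class); `M17P` has no x-linear form) -/

/-- `LD17 2` IS node 11's `L17P` (decided by node 10's norm shape, §9 — NOT by the Thue–Mahler class: `deg B = 2 < 3`). -/
theorem LD17_two : LD17 2 = L17P := rfl

/-- `M17P = Y⁴ + x(Y+1) + x²(Y² − 17)` is NOT in the class (no x-linear presentation; tree `M17P_ne_xLinP`). -/
theorem not_xLinTM_M17P : ¬ XLinTM M17P := fun ⟨A, B, _, _, _, _, h⟩ => M17P_ne_xLinP A B h

/-- the ℤ[X]-spelling of coprimality IMPLIES the assumed ℚ-spelling … -/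
theorem isCoprime_map_of_isCoprime_int {A B : ℤ[X]} (h : IsCoprime A B) :
    IsCoprime (A.map (Int.castRingHom ℚ)) (B.map (Int.castRingHom ℚ)) := h.map (Polynomial.mapRingHom (Int.castRingHom ℚ))

/-- … and is STRICTLY stronger: it FAILS for the member `L17C` (`u·(Y+3) + v·(Y³−17) = 1` at `Y = −3` gives `−44·v(−3) = 1`),
although `Y + 3 ⊥ Y³ − 17` over `ℚ` (`isCoprime_X_add_three_b17 3`). -/
theorem not_isCoprime_int_L17C : ¬ IsCoprime (X + C 3 : ℤ[X]) (b17 3) := by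
  rintro ⟨u, v, huv⟩
  have h := congrArg (eval (-3 : ℤ)) huv
  simp only [b17, eval_add, eval_mul, eval_X, eval_C, eval_one, eval_sub, eval_pow] at h
  omega

/-- the ℤ[X]-spelling of separability IMPLIES the assumed ℚ-spelling … -/
theorem separable_map_of_separable_int {B : ℤ[X]} (h : B.Separable) : (B.map (Int.castRingHom ℚ)).Separable := h.map

/-- … and is STRICTLY stronger: `Y³ − 17` is NOT separable as an element of `ℤ[X]` (`u·(Y³−17) + v·3Y² = 1` at `Y = −1` gives
`3 ∣ 1`), although it is separable over `ℚ` (`separable_b17`). -/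
theorem not_separable_int_b17_three : ¬ (b17 3).Separable := by
  intro hs
  obtain ⟨u, v, huv⟩ := hs
  have h := congrArg (eval (-1 : ℤ)) huv
  simp only [b17, derivative_sub, derivative_X_pow, derivative_C, sub_zero, eval_add, eval_mul, eval_X, eval_C, eval_one,
    eval_sub, eval_pow] at h
  omega

/-- SHARPNESS of separability: a SQUARE top `B₀²` (`deg B₀ ≥ 1`, e.g. `(Y² − 17)²`) is refused by the class. -/
theorem not_separable_sq_map (B₀ : ℤ[X]) (h : 0 < B₀.natDegree) : ¬ ((B₀ ^ 2).map (Int.castRingHom ℚ)).Separable := by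
  intro hs
  rw [Polynomial.map_pow] at hs
  have hu : ¬ IsUnit (B₀.map (Int.castRingHom ℚ)) := by
    apply Polynomial.not_isUnit_of_natDegree_pos
    rwa [natDegree_map_eq_of_injective (Int.castRingHom ℚ).injective_int]
  have := (Polynomial.Separable.of_pow hu two_ne_zero hs).2
  omega

/-- SHARPNESS of coprimality: a COMMON ROOT (`A = (Y−1)·A'`, `B = (Y−1)·B'`) is refused by the class. -/
theorem not_isCoprime_common_root (A' B' : ℤ[X]) :
    ¬ IsCoprime (((X - C 1) * A').map (Int.castRingHom ℚ)) (((X - C 1) * B').map (Int.castRingHom ℚ)) := fun h => by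
  rcases aeval_ne_zero_or_of_isCoprime h (1 : ℚ) with h1 | h1 <;>
    simp [map_mul, map_sub, aeval_X] at h1

end Summit.Schanuel.Schanuel.Theorems.RootDecomp1KThueMahler

end
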